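import Mathlib
import HarnessLib
import Summits.AtomisticToContinuum.Crystallization.Theorems.PricedLinkCensusSoftFourRingsInterior

/-!
# The twelve link directions surround the centre — `Cap` variant (local covering hypothesis)

Route `PricedLinkCensus`, item `SoftFourRings` (stmt-AtomisticToContinuum-14234).  Second root of
the `Cap` variant of the soft-four-rings chain (seat c3; see
`PricedLinkCensusSoftFourRingsCapFacetCap`): `0 ∈ interior (conv X)` for a finite set of unit
vectors `X` with the LOCAL covering property `∀ p, ‖p‖ = 1 → ∃ x ∈ X, dist p x < 0.957` — if all of
`X` lay in a closed hemisphere `⟪v, ·⟫ ≥ 0`, the pole `−v/‖v‖` would be at chordal distance `≥ √2`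
from `X`.  Same names and argument lists as the tree's Tammes-conditional lemmas of
`PricedLinkCensusSoftFourRingsInterior` (namespace `…Theorems.Cap`), whose hT-free Hahn–Banach
lemmas are reused.
-/

namespace Summit.AtomisticToContinuum.Crystallization.Theorems.Cap

open Real RealInnerProductSpace Literature.Geometry.DiscreteGeometry

/-- **A `0.957`-covering set of unit vectors meets every open hemisphere**: if every unit vector
is within chordal distance `0.957` of `X`, then for every `v ≠ 0` some `x ∈ X` has `⟪v, x⟫ < 0`
(else the pole `−v/‖v‖` is at distance `≥ √2 > 0.957` from all of `X`).  (`_hcard`, `_hsep` unused,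
kept for positional compatibility with the tree's lemma.) [folklore] -/
theorem exists_inner_neg_of_twelve_le_card {X : Finset (EuclideanSpace ℝ (Fin 3))}
    (hT : ∀ p : EuclideanSpace ℝ (Fin 3), ‖p‖ = 1 → ∃ x ∈ X, dist p x < 0.957)
    (hX1 : ∀ y ∈ X, ‖y‖ = 1) (_hcard : 12 ≤ X.card)
    (_hsep : ∀ u ∈ X, ∀ v ∈ X, u ≠ v → (0.957 : ℝ) ≤ dist u v)
    {v : EuclideanSpace ℝ (Fin 3)} (hv : v ≠ 0) : ∃ x ∈ X, ⟪v, x⟫ < 0 := by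
  by_contra hcon
  push Not at hcon
  set p : EuclideanSpace ℝ (Fin 3) := (-‖v‖⁻¹) • v with hp
  have hvn : 0 < ‖v‖ := norm_pos_iff.2 hv
  have hp1 : ‖p‖ = 1 := by
    rw [hp, norm_smul, norm_neg, norm_inv, norm_norm, inv_mul_cancel₀ hvn.ne']
  have hpx : ∀ x ∈ X, ⟪p, x⟫ ≤ 0 := by
    intro x hx
    rw [hp, real_inner_smul_left]
    exact mul_nonpos_of_nonpos_of_nonneg (neg_nonpos.2 (inv_nonneg.2 hvn.le)) (hcon x hx)
  obtain ⟨x, hx, hdx⟩ := hT p hp1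
  have hd : dist p x ^ 2 = 2 - 2 * ⟪p, x⟫ := by
    rw [dist_eq_norm, ← real_inner_self_eq_norm_sq, inner_sub_left, inner_sub_right,
      inner_sub_right, real_inner_self_eq_norm_sq, real_inner_self_eq_norm_sq, hp1, hX1 x hx,
      real_inner_comm p x]
    ring
  have h2 : dist p x ^ 2 < (0.957 : ℝ) ^ 2 := pow_lt_pow_left₀ hdx dist_nonneg two_ne_zero
  rw [hd] at h2
  linarith [hpx x hx]

/-- **A `0.957`-covering set of unit vectors surrounds the centre**: `0 ∈ interior (conv X)` — the
standing hypothesis of the tree's `euler_formula` / `card_hullEdges_le` for spherical subdivisions.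
(Same name and argument list as the tree's Tammes-conditional lemma.) [folklore] -/
theorem zero_mem_interior_convexHull_of_twelve_le_card {X : Finset (EuclideanSpace ℝ (Fin 3))}
    (hT : ∀ p : EuclideanSpace ℝ (Fin 3), ‖p‖ = 1 → ∃ x ∈ X, dist p x < 0.957)
    (hX1 : ∀ y ∈ X, ‖y‖ = 1) (hcard : 12 ≤ X.card)
    {ca : ℝ} (hca : 2 * ca ≤ 2 - 0.957 ^ 2) (hsep : ∀ u ∈ X, ∀ v ∈ X, u ≠ v → ⟪u, v⟫ ≤ ca) :
    (0 : EuclideanSpace ℝ (Fin 3)) ∈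
      interior (convexHull ℝ (X : Set (EuclideanSpace ℝ (Fin 3)))) := by
  have hX : (X : Set (EuclideanSpace ℝ (Fin 3))).Nonempty := by
    have : X.Nonempty := Finset.card_pos.1 (by omega)
    exact this.coe_sort.elim fun x => ⟨x.1, x.2⟩
  have hdist : ∀ u ∈ X, ∀ v ∈ X, u ≠ v → (0.957 : ℝ) ≤ dist u v := by
    intro u hu v hv huv
    have hd : dist u v ^ 2 = 2 - 2 * ⟪u, v⟫ := by
      rw [dist_eq_norm, ← real_inner_self_eq_norm_sq, inner_sub_left, inner_sub_right,
        inner_sub_right, real_inner_self_eq_norm_sq, real_inner_self_eq_norm_sq, hX1 u hu,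
        hX1 v hv, real_inner_comm u v]
      ring
    have h2 : (0.957 : ℝ) ^ 2 ≤ dist u v ^ 2 := by
      rw [hd]; linarith [hsep u hu v hv huv]
    exact (pow_le_pow_iff_left₀ (by norm_num) dist_nonneg two_ne_zero).1 h2
  exact zero_mem_interior_convexHull_of_forall_exists_inner_neg hX fun v hv =>
    exists_inner_neg_of_twelve_le_card hT hX1 hcard hdist hv

end Summit.AtomisticToContinuum.Crystallization.Theorems.Cap
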